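import Summits.QuantumFields.BalabanUV.T4Continuum.Support.NE7ApeCurvedRepDockingStrong
import Summits.QuantumFields.BalabanUV.T4Continuum.Support.NE7TangentTransportSameTopDocked
import HarnessLib

/-!
# NE7ApeCurvedRepSameTop — (APE) WITH A DATUM FOR A FIBRE-PRESERVING REPRESENTATIVE, THE TRANSPORT LETTER DISCHARGED: F66's composition with the Landau
# representative DISPLAYED (`U^u = W e^{Z}`, `cavgIter (j+1) (We^{Z}) = cavgIter (j+1) W`) instead of produced by E′, `hEXP` by F65 and **`hTT` by F75** — the
# remaining analytic letters are exactly (L1) the normal lift, the gradient member `α₁`, (L2) the slice solver and (L3) the background tension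

Cell `pub-balaban`, rung (B)+1 sub-cell t4, lineage `b2b-balaban-t4-ne7-p1` (CRUX PROVER NE7 #1 = OWNER of row NE7), generation 76; memo
`t4/b2b-balaban-t4-ne7-p1-g76/TT-CURVED-LETTER.md` §4.  File F76 (over F59 `NE7CurvedLiftBookkeepingApprox.smallField_vary_of_curvedLetters_approxNorth`, F65
`NE7ExpansionRemainderCurvedStrong.abs_dAction_vary_sub_dAction_sub_hess_le_W_strong`, F75 `NE7TangentTransportSameTopDocked.hTT_sameTop`, F39
`NE7TanCriticalGauge.tanCritical_gaugeAct`, `NE7ConvOneStepWeightedUnique.smallField_of_gaugeAct_eq`).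
WHY.  F66 `NE7ApeCurvedRepDockingStrong` = (APE) with a datum ⇐ E′ (REP) + (L1) + α₁ + (L2) + (L3) + (L4), with (L4) = `hTT` quantified over ALL Landau representatives.
This gen's located point (F70∕F74): `hTT` closes in currency only for representatives over the SAME top datum as the background, and E′'s representative is not of that
kind.  THIS FILE therefore DISPLAYS the representative — a unitary periodic `u` and a skew periodic `Z` with `U^u = We^{Z}`, `‖Z‖ ≤ α₀` and `cavgIter (j+1) (We^{Z}) =
cavgIter (j+1) W` («REP WITH A FIXED TOP», to be constructed) — and DISCHARGES `hTT` by F75: the conclusion is F66's with `τ` replaced by F75's explicit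
`x′·c₁(x′)·(M^d∕M²)·K_maj·q^j·(C₁L^j(e^{α₀} − 1) + C₂(L²)^j x′)`, `x′ = x + 4(e^{α₀} − 1)`.  What remains displayed: (L1) the normal lift of `Z` at `W` (approximate NORTH
`ν`), the covariant gradient member `α₁` of `Z`, (L2) the slice solver `K_G` at `W`, (L3) the background tension `κ` (0 at a tangent-critical `W`).
WHAT ([folklore]; 0 def, 0 sorry).  **`smallField_of_tanCritical_repSameTop`**.
HONEST FRAMING (page 1): composition; the fixed-top representative, (L1), `α₁`, (L2), (L3) are HYPOTHESES; nothing of Bałaban's asserted ([Balaban1985Variational] Sect. F TYPE);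
(APE) on curved data NOT proved; NOT ONE-STEP, NOT NE7; spine 0∕9; finite T⁴ rung (B)+1 — NOT infinite volume, NOT mass gap, NOT `BetaPertH`, NOT Clay.  Continuum YM on
T⁴ ⇐ BetaPertH ∧ nine spine estimates (0/9 proved); BetaPertH ⇐ (D1) ∧ (D4) ∧ CAP+tail; G-an2-4 gates asym, D1 and NE2/3/4.
-/

set_option autoImplicit false

open scoped BigOperators Matrix Matrix.Norms.L2Operator
open NormedSpace Finset Set

namespace Summit.QuantumFields.BalabanUV.T4Continuum.NE7ApeCurvedRepSameTop

open Literature.MathematicalPhysics.QuantumFieldTheory.Balaban1983to89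
open B7Prop1Explicit B7Prop2Explicit MatrixLog UnitaryModel
open T4AveragingDeficitWall (Ad IsUnitaryCfg IsSkewDir SmallField vary curlAt dirL1)
open T4AveragingDeficitWallBoundary (IsPeriodicCfg periodBox)
open AveragingDeficitPeriodicCounting (IsPeriodicDir)
open AveragingDeficitTwoLevelPrep (twoLevelSmall)
open AveragingDeficitMultiLevelPrep (cavgIter LevelSmall)
open MinimalActionLevels (perWin)
open BlockAverageVaryHolo (nbRad)
open NE3HessForm (hess dAction)
open NE3TangentCovariantTower (dirIter)
open NE3EnergyShapes (IsUnitarySite IsPeriodicSite)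
open NE3QbarIterCovLiftPrep (cruxC)
open NE3RightInverseSolveLetters (thetaLoc)
open NE3HatInvCurlLetters (curl1C curl1C_nonneg)
open NE7TanCriticalGauge (tanCritical_gaugeAct)
open NE7ConvOneStepWeightedUnique (smallField_of_gaugeAct_eq)
open NE7CurvedLiftBookkeepingApprox (smallField_vary_of_curvedLetters_approxNorth)
open NE7ExpansionRemainderCurvedStrong (abs_dAction_vary_sub_dAction_sub_hess_le_W_strong)
open NE7TangentTransportSameTopDocked (hTT_sameTop)

noncomputable section

variable {d : ℕ} {n : Type*} [Fintype n] [DecidableEq n]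

/-- **(APE) WITH A DATUM FOR A FIBRE-PRESERVING REPRESENTATIVE, `hTT` DISCHARGED** (statement in the module docstring). [folklore] -/
theorem smallField_of_tanCritical_repSameTop [Nonempty n] (hd : 2 ≤ d) {L N : ℕ} [NeZero N] (hL : 2 ≤ L) (j : ℕ)
    -- the background
    {W : Site d → Fin d → (Matrix n n ℂ)ˣ} {x : ℝ} (hWu : IsUnitaryCfg W) (hWP : IsPeriodicCfg W ((N * L ^ (j + 1) : ℕ) : ℤ))
    (hx : 0 ≤ x) (hs : LevelSmall d L j x) (hWx : SmallField W x)
    -- the sup radius of the representative and the regime at `x′ = x + 4(e^{α₀} − 1)`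
    {α₀ : ℝ} (hα0 : 0 ≤ α₀) (hs' : LevelSmall d L j (x + 4 * (Real.exp α₀ - 1)))
    (hθ : cruxC d L * (((L : ℝ) ^ (j + 1)) ^ 2 * (x + 4 * (Real.exp α₀ - 1))) < 1)
    (hθl : thetaLoc d L * (((L : ℝ) ^ (j + 1)) ^ 2 * (x + 4 * (Real.exp α₀ - 1))) < 1)
    (hε : ((L : ℝ) ^ (j + 1)) ^ 2 * (x + 4 * (Real.exp α₀ - 1)) ≤ 1)
    -- the field: of the class, tangent-critical
    {U : Site d → Fin d → (Matrix n n ℂ)ˣ} (hUu : IsUnitaryCfg U)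
    {xU : ℝ} (hxU : 0 ≤ xU) (hsU : LevelSmall d L j xU) (hUxU : SmallField U xU)
    (hcritU : ∀ Y : Site d → Fin d → Matrix n n ℂ, IsSkewDir Y → IsPeriodicDir Y ((N * L ^ (j + 1) : ℕ) : ℤ) →
      dirIter L (j + 1) U Y = 0 → dAction U Y (perWin d (N * L ^ (j + 1))) = 0)
    -- the DISPLAYED fibre-preserving representative `U^u = W e^{Z}`
    {u : Site d → (Matrix n n ℂ)ˣ} (huU : IsUnitarySite u) (huP : IsPeriodicSite u ((N * L ^ (j + 1) : ℕ) : ℤ))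
    {Z : Site d → Fin d → Matrix n n ℂ} (hZs : IsSkewDir Z) (hZP : IsPeriodicDir Z ((N * L ^ (j + 1) : ℕ) : ℤ))
    (hrep : gaugeAct u U = vary W Z 1) (hZα : ∀ y μ, ‖Z y μ‖ ≤ α₀)
    (hTopZ : cavgIter L (j + 1) (vary W Z 1) = cavgIter L (j + 1) W)
    -- the remaining analytic letters at `W`: (L1) normal lift of `Z`, the gradient member, (L2) slice solver, (L3) tension
    (S : Set (Site d → Fin d → Matrix n n ℂ)) {cN KG κ ν : ℝ} (hκ : 0 ≤ κ) (hν : 0 ≤ ν)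
    {AN : Site d → Fin d → Matrix n n ℂ} (hNP : IsPeriodicDir AN ((N * L ^ (j + 1) : ℕ) : ℤ))
    (hNexact : dirIter L (j + 1) W AN = dirIter L (j + 1) W Z)
    (hN7 : ∀ z μ' ν', μ' ≠ ν' → ‖curlAt W AN z μ' ν'‖ ≤ cN)
    (hNorth : ∀ Y : Site d → Fin d → Matrix n n ℂ, IsSkewDir Y → IsPeriodicDir Y ((N * L ^ (j + 1) : ℕ) : ℤ) → dirIter L (j + 1) W Y = 0 →
      |hess W AN Y (perWin d (N * L ^ (j + 1)))| ≤ ν * dirL1 Y (periodBox (d := d) (N * L ^ (j + 1))))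
    (hTS : (fun y μ => Z y μ - AN y μ) ∈ S)
    {α₁ : ℝ} (hα1 : 0 ≤ α₁) (hZ1 : ∀ (y : Site d) (κ τ : Fin d), ‖Ad (W (y + e κ) τ) (Z (y + e τ) κ) - Z y κ‖ ≤ α₁)
    (hG : ∀ X ∈ S, IsPeriodicDir X ((N * L ^ (j + 1) : ℕ) : ℤ) → dirIter L (j + 1) W X = 0 → ∀ g : ℝ, 0 ≤ g →
      (∀ Y : Site d → Fin d → Matrix n n ℂ, IsSkewDir Y → IsPeriodicDir Y ((N * L ^ (j + 1) : ℕ) : ℤ) → dirIter L (j + 1) W Y = 0 →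
        |hess W X Y (perWin d (N * L ^ (j + 1)))| ≤ g * dirL1 Y (periodBox (d := d) (N * L ^ (j + 1)))) →
      ∀ z μ' ν', μ' ≠ ν' → ‖curlAt W X z μ' ν'‖ ≤ KG * g)
    (hWten : ∀ Y : Site d → Fin d → Matrix n n ℂ, IsSkewDir Y → IsPeriodicDir Y ((N * L ^ (j + 1) : ℕ) : ℤ) → dirIter L (j + 1) W Y = 0 →
      |dAction W Y (perWin d (N * L ^ (j + 1)))| ≤ κ * dirL1 Y (periodBox (d := d) (N * L ^ (j + 1)))) :
    SmallField U (x + (KG * (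
        ((x + 4 * (Real.exp α₀ - 1))
            * ((curl1C d L / (1 - thetaLoc d L * (((L : ℝ) ^ (j + 1)) ^ 2 * (x + 4 * (Real.exp α₀ - 1)))))
                * (((L : ℝ) ^ (j + 1)) ^ d / ((L : ℝ) ^ (j + 1)) ^ 2))
            * (Real.exp (((L : ℝ) ^ d / L) * ((d : ℝ) * (16 * ((d : ℝ) + 1) * ((d : ℝ) + 4) * (L : ℝ) ^ 2)
                  * (1250 * ((nbRad d L : ℝ) + L) + 8 * ((d : ℝ) * L) + 2 * L)) * (2 / twoLevelSmall d L))
                * ((L : ℝ) / (L : ℝ) ^ d) ^ j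
                * (((d : ℝ) * (2 * nbRad d L + 1) ^ d) * ((2 * (d : ℝ) + 4) * (L : ℝ) ^ 2) * (2 * (L : ℝ) ^ j) * (Real.exp α₀ - 1)
                  + (17 / 8 * ((L : ℝ) ^ 2) ^ j * (x + 4 * (Real.exp α₀ - 1)))
                    * (((d : ℝ) * (2 * nbRad d L + 1) ^ d) * ((2 * (d : ℝ) + 4)
                          * (2 * (2 * L * (nbRad d L : ℝ) + 128 * ((d : ℝ) + 1) * ((d : ℝ) + 4) * (L : ℝ) ^ 2)))
                      + ((d : ℝ) * (2 * nbRad d L + 1) ^ d) * ((2 * (d : ℝ) + 4) * (L : ℝ) ^ 2 * (2 * (nbRad d L : ℝ))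
                          + 2 * (8 * (L : ℝ) + (1250 * ((nbRad d L : ℝ) + L) + 8 * (d * L) + 2 * L))
                              * (16 * ((d : ℝ) + 1) * ((d : ℝ) + 4) * (L : ℝ) ^ 2))))))
        + (Fintype.card (T4AveragingDeficitWall.Plane d) : ℝ)
          * (2 * (240 * (Real.exp α₀ - 1) * α₀ * (2 * α₁ + 24 * α₀ * (Real.exp α₀ - 1) + x) + 8 * α₀ * (2 * α₁ + 24 * α₀ * (Real.exp α₀ - 1))
              + 6 * (Real.exp α₀ - 1) * (2 * α₁ + 24 * (Real.exp α₀ - 1) * α₀)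
              + (2 * α₁ + 24 * (Real.exp α₀ - 1) * α₀) * (2 * α₁ + 24 * α₀ * (Real.exp α₀ - 1))
              + 960 * (Real.exp α₀ - 1) * α₀ ^ 2 + 32 * x * α₀ ^ 2)
            + (64 * α₀ * α₁ + 1024 * x * α₀ ^ 2))
        + κ + ν) + cN + 28 * α₀ ^ 2)) := by
  have hL1 : 1 ≤ L := by omega
  have hP : 1 ≤ N * L ^ (j + 1) := Nat.mul_pos (Nat.pos_of_ne_zero (NeZero.ne N)) (Nat.pow_pos (by omega))
  have he0 : 0 ≤ Real.exp α₀ - 1 := by have := Real.add_one_le_exp α₀; linarith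
  -- hEXP by F65 (strong curved remainder)
  have hρ0 : 0 ≤ (Fintype.card (T4AveragingDeficitWall.Plane d) : ℝ)
          * (2 * (240 * (Real.exp α₀ - 1) * α₀ * (2 * α₁ + 24 * α₀ * (Real.exp α₀ - 1) + x) + 8 * α₀ * (2 * α₁ + 24 * α₀ * (Real.exp α₀ - 1))
              + 6 * (Real.exp α₀ - 1) * (2 * α₁ + 24 * (Real.exp α₀ - 1) * α₀)
              + (2 * α₁ + 24 * (Real.exp α₀ - 1) * α₀) * (2 * α₁ + 24 * α₀ * (Real.exp α₀ - 1))
              + 960 * (Real.exp α₀ - 1) * α₀ ^ 2 + 32 * x * α₀ ^ 2)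
            + (64 * α₀ * α₁ + 1024 * x * α₀ ^ 2)) := by positivity
  have hEXP : ∀ Y : Site d → Fin d → Matrix n n ℂ, IsSkewDir Y → IsPeriodicDir Y ((N * L ^ (j + 1) : ℕ) : ℤ) →
      |dAction (vary W Z 1) Y (perWin d (N * L ^ (j + 1))) - dAction W Y (perWin d (N * L ^ (j + 1))) - hess W Z Y (perWin d (N * L ^ (j + 1)))|
        ≤ (Fintype.card (T4AveragingDeficitWall.Plane d) : ℝ)
          * (2 * (240 * (Real.exp α₀ - 1) * α₀ * (2 * α₁ + 24 * α₀ * (Real.exp α₀ - 1) + x) + 8 * α₀ * (2 * α₁ + 24 * α₀ * (Real.exp α₀ - 1))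
              + 6 * (Real.exp α₀ - 1) * (2 * α₁ + 24 * (Real.exp α₀ - 1) * α₀)
              + (2 * α₁ + 24 * (Real.exp α₀ - 1) * α₀) * (2 * α₁ + 24 * α₀ * (Real.exp α₀ - 1))
              + 960 * (Real.exp α₀ - 1) * α₀ ^ 2 + 32 * x * α₀ ^ 2)
            + (64 * α₀ * α₁ + 1024 * x * α₀ ^ 2))
          * dirL1 Y (periodBox (d := d) (N * L ^ (j + 1))) :=
    fun Y _ hYP => abs_dAction_vary_sub_dAction_sub_hess_le_W_strong hP hWu hWP hx hWx hZs hZP hα0 hα1 hZα hZ1 hYP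
  -- tangent-criticality is gauge covariant
  have hcrit' : ∀ Y' : Site d → Fin d → Matrix n n ℂ, IsSkewDir Y' → IsPeriodicDir Y' ((N * L ^ (j + 1) : ℕ) : ℤ) →
      dirIter L (j + 1) (vary W Z 1) Y' = 0 → dAction (vary W Z 1) Y' (perWin d (N * L ^ (j + 1))) = 0 := by
    rw [← hrep]
    exact tanCritical_gaugeAct hL1 j hUu hxU hsU hUxU huU huP hcritU
  -- hTT by F75 (fibre-preserving representative)
  have hTT := hTT_sameTop hd hL j hWu hWP hx hα0 hWx hs' hθ hθl hε Z hZs hZP hZα hTopZ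
  -- the transport constant is nonnegative
  set e1 : ℝ := Real.exp α₀ - 1 with he1
  have hden : 0 < 1 - thetaLoc d L * (((L : ℝ) ^ (j + 1)) ^ 2 * (x + 4 * e1)) := by linarith
  have hc1 := curl1C_nonneg d L
  have htw : 0 < twoLevelSmall d L := by unfold twoLevelSmall; positivity
  have hτ : 0 ≤ ((x + 4 * e1)
            * ((curl1C d L / (1 - thetaLoc d L * (((L : ℝ) ^ (j + 1)) ^ 2 * (x + 4 * e1))))
                * (((L : ℝ) ^ (j + 1)) ^ d / ((L : ℝ) ^ (j + 1)) ^ 2))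
            * (Real.exp (((L : ℝ) ^ d / L) * ((d : ℝ) * (16 * ((d : ℝ) + 1) * ((d : ℝ) + 4) * (L : ℝ) ^ 2)
                  * (1250 * ((nbRad d L : ℝ) + L) + 8 * ((d : ℝ) * L) + 2 * L)) * (2 / twoLevelSmall d L))
                * ((L : ℝ) / (L : ℝ) ^ d) ^ j
                * (((d : ℝ) * (2 * nbRad d L + 1) ^ d) * ((2 * (d : ℝ) + 4) * (L : ℝ) ^ 2) * (2 * (L : ℝ) ^ j) * e1
                  + (17 / 8 * ((L : ℝ) ^ 2) ^ j * (x + 4 * e1))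
                    * (((d : ℝ) * (2 * nbRad d L + 1) ^ d) * ((2 * (d : ℝ) + 4)
                          * (2 * (2 * L * (nbRad d L : ℝ) + 128 * ((d : ℝ) + 1) * ((d : ℝ) + 4) * (L : ℝ) ^ 2)))
                      + ((d : ℝ) * (2 * nbRad d L + 1) ^ d) * ((2 * (d : ℝ) + 4) * (L : ℝ) ^ 2 * (2 * (nbRad d L : ℝ))
                          + 2 * (8 * (L : ℝ) + (1250 * ((nbRad d L : ℝ) + L) + 8 * (d * L) + 2 * L))
                              * (16 * ((d : ℝ) + 1) * ((d : ℝ) + 4) * (L : ℝ) ^ 2)))))) := by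
    have h1 : 0 ≤ curl1C d L / (1 - thetaLoc d L * (((L : ℝ) ^ (j + 1)) ^ 2 * (x + 4 * e1))) := div_nonneg hc1 hden.le
    positivity
  -- F59 on the representative
  have hSF := smallField_vary_of_curvedLetters_approxNorth hL1 j hWu hx hs hWx hZs hZP hZα hNP hNexact hN7 hν hNorth S hTS hG hρ0 hEXP hκ hWten
    hcrit' hτ hTT
  -- the radius is gauge invariant
  exact smallField_of_gaugeAct_eq huU hrep hSF

end

end Summit.QuantumFields.BalabanUV.T4Continuum.NE7ApeCurvedRepSameTop
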